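import Literature.AlgebraicGeometry.HodgeTheory.AtiyahClassTraceReal
import Literature.AlgebraicGeometry.Motives.CompleteIntersection
import Literature.AlgebraicGeometry.Motives.HypersurfaceFormsNonsingular
import Literature.AlgebraicGeometry.Motives.Sweep1
import Literature.AlgebraicGeometry.Motives.CrystallineRealization
import Mathlib.RingTheory.WittVector.Basic
import HarnessLib

/-!
# Crux `PadicSemiregularLift.SemiregularSeedsOnAnchors` (stmt-HodgeConjecture-13941): objects of the
# line `gorenstein-ci-seeds`

Definitions (no proofs of stubs, no named facts about them) used by the positive-side files of this
crux, i.e. by the registered stubs of the checked skeleton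
`Cruxes/SemiregularSeedsOnAnchors/Lines/gorenstein-ci-seeds.lean` (crux-plan generation 2; lead
`prover-line-stmt-HodgeConjecture-13941-0`) and by its composition theorem
`SemiregularSeedsOnAnchorsAt_of` / `SemiregularSeedsOnFermatScope_of`. Statements are verbatim those of
the planner's checked skeleton; they are moved here so that stub files under `Theorems/` can import
them (a `Theorems` file may not import a `Cruxes` work file).

* §1 commutative algebra of CI-TYPE DATA for a form `F` of degree `m` in `k[x₀,…,x₅]`: the Jacobian
  ideal `jacobianIdeal F`, the structure `CIDatum F m` (`F = Σ fᵢ gᵢ`, `(f)` radical), the six forms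
  `H = (f, g)`, the ideal `⟨f, g⟩`, the TRANSITION DETERMINANT `P_Z = det (∂ⱼ Hᵢ)` (Villaflor,
  arXiv:1812.03964, Thm 1 / Rem 1), and the linkage corollary `transitionDet_not_mem_of_colon_eq`;
* §2 geometry on real carriers: `HasRangeZeroLocus ι F` (`ι : X ↪ ℙ⁵` onto `V₊(F)`) and
  `IsHartshorneSerreOf ι f E` (`E` is a Hartshorne–Serre bundle of `V₊(f) ∩ X`: Arrondo 2007 Thm 1.1);
* §3 characters of the Fermat fourfold `X⁴_m` (Shioda 1979): admissible / type `(2,2)` / totally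
  Hodge / saturated / three-pair characters, `H_a`-eigenpolynomials, the exponent `a − 1`, diagonal
  rescaling, and for CI data of the Fermat form: `H_a`-stability, VISIBILITY at `a`, diagonal
  translates, liftability to `W(k)`, GOOD data;
The five registered stub STATEMENTS (S1 `stub_jacobianColon_eq`, S2 `stub_serreBundle_exists`,
S3 `stub_serreBundle_isOneSemiregular`, S4a `stub_linearCycleSupply`, S4b `stub_eigenCISupply`) are NOT
restated here: each stub file states its registered signature over this vocabulary directly, and the
skeleton keeps the named `Prop`s for its composition (so a reshaped stub never freezes a dead statement
in this append-only file).

Sources: R. Villaflor Loyola, *Periods of complete intersection algebraic cycles*, arXiv:1812.03964,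
§1, Thm 1, Rem 1, Cor 3; H. Movasati, R. Villaflor Loyola, arXiv:1705.00084 (linear cycles);
E. Arrondo, *A home-made Hartshorne–Serre correspondence*, Rev. Mat. Complut. 20 (2007) Thm 1.1;
T. Shioda, *The Hodge conjecture for Fermat varieties*, Math. Ann. 245 (1979) §1, Thm I;
R.-O. Buchweitz, H. Flenner, Compositio Math. 137 (2003) (semiregularity map `σ₁`).
-/

noncomputable section

-- `Summit.HodgeConjecture.HodgeConjecture.…` (summit = problem) duplicates a namespace component by design (D-0017).
set_option linter.dupNamespace false

open CategoryTheory AlgebraicGeometry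
open Literature.AlgebraicGeometry.Motives Literature.AlgebraicGeometry.HodgeTheory
  Literature.AlgebraicGeometry.Modules

universe u

namespace Summit.HodgeConjecture.HodgeConjecture.Theorems.SemiregularSeedsOnAnchors.GorensteinCiSeeds

/-! ## §1 Commutative algebra of CI-type data (`k[x₀,…,x₅]`) -/

section Algebra

variable {k : Type u} [Field k]

/-- The Jacobian ideal `J^F = (∂₀F, …, ∂₅F)` of a form in six variables.
[cite: Villaflor2022PeriodsCI, §1] -/
def jacobianIdeal (F : MvPolynomial (Fin 6) k) : Ideal (MvPolynomial (Fin 6) k) :=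
  Ideal.span (Set.range fun j : Fin 6 => MvPolynomial.pderiv j F)

/-- A REDUCED CI-TYPE DATUM for a form `F` of degree `m` in six variables: homogeneous
`f₁,f₂,f₃,g₁,g₂,g₃ ≠ 0` with `deg fᵢ = dᵢ`, `deg gᵢ = m − dᵢ`, `1 ≤ dᵢ < m`, `Σ fᵢ gᵢ = F`, and
`(f₁,f₂,f₃)` a radical ideal (so that the reduced `completeIntersection f` is the complete-intersection
surface `Z = V₊(f₁,f₂,f₃) ⊂ ℙ⁵` when `X = V₊(F)` is smooth). [cite: Villaflor2022PeriodsCI, §1] -/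
structure CIDatum (F : MvPolynomial (Fin 6) k) (m : ℕ) where
  /-- degrees of the `fᵢ` -/
  d : Fin 3 → ℕ
  /-- the forms cutting out `Z` -/
  f : Fin 3 → MvPolynomial (Fin 6) k
  /-- the complementary forms -/
  g : Fin 3 → MvPolynomial (Fin 6) k
  /-- `1 ≤ dᵢ` -/
  one_le_d : ∀ i, 1 ≤ d i
  /-- `dᵢ < m` -/
  d_lt : ∀ i, d i < m
  /-- `fᵢ` homogeneous of degree `dᵢ` -/
  f_hom : ∀ i, (f i).IsHomogeneous (d i)
  /-- `gᵢ` homogeneous of degree `m − dᵢ` -/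
  g_hom : ∀ i, (g i).IsHomogeneous (m - d i)
  /-- `fᵢ ≠ 0` -/
  f_ne : ∀ i, f i ≠ 0
  /-- `gᵢ ≠ 0` -/
  g_ne : ∀ i, g i ≠ 0
  /-- `Σ fᵢ gᵢ = F` -/
  sum_eq : ∑ i, f i * g i = F
  /-- `(f₁, f₂, f₃)` is radical -/
  radical : (Ideal.span (Set.range f)).IsRadical

namespace CIDatum

variable {F : MvPolynomial (Fin 6) k} {m : ℕ}

/-- The six forms `H = (f₁,f₂,f₃,g₁,g₂,g₃)`. [cite: Villaflor2022PeriodsCI, §1] -/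
def H (Z : CIDatum F m) : Fin 6 → MvPolynomial (Fin 6) k :=
  fun i => Sum.elim Z.f Z.g ((finSumFinEquiv (m := 3) (n := 3)).symm (Fin.cast rfl i))

/-- The ideal `⟨f, g⟩ = (H₀, …, H₅)`; `A = k[x]/⟨f,g⟩` is the Artinian Gorenstein algebra of the line.
[cite: Villaflor2022PeriodsCI, Rem 1] -/
def ideal (Z : CIDatum F m) : Ideal (MvPolynomial (Fin 6) k) :=
  Ideal.span (Set.range Z.H)

/-- The TRANSITION DETERMINANT `P_Z = det (∂ⱼ Hᵢ)` (Villaflor's `det Jac(H)`: `[Z]_prim` corresponds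
to `c · P_Z`, `c ≠ 0`, under `H^{2,2}_prim ≅ R^F_{3m−6}`); homogeneous of degree `3m − 6`.
[cite: Villaflor2022PeriodsCI, Thm 1] -/
def transitionDet (Z : CIDatum F m) : MvPolynomial (Fin 6) k :=
  Matrix.det (Matrix.of fun i j : Fin 6 => MvPolynomial.pderiv j (Z.H i))

/-- Every `Hᵢ` is homogeneous of POSITIVE degree. [folklore] -/
theorem exists_isHomogeneous_H (Z : CIDatum F m) (i : Fin 6) :
    ∃ n, 0 < n ∧ (Z.H i).IsHomogeneous n := by
  unfold CIDatum.H
  cases (finSumFinEquiv (m := 3) (n := 3)).symm (Fin.cast rfl i) with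
  | inl a => exact ⟨Z.d a, Z.one_le_d a, Z.f_hom a⟩
  | inr a => exact ⟨m - Z.d a, Nat.sub_pos_of_lt (Z.d_lt a), Z.g_hom a⟩

/-- `⟨f, g⟩` is a proper ideal (all generators have positive degree, so constant coefficients of its
members vanish). [folklore] -/
theorem ideal_ne_top (Z : CIDatum F m) : Z.ideal ≠ ⊤ := by
  intro htop
  have key : ∀ q ∈ Z.ideal, MvPolynomial.constantCoeff q = 0 := by
    intro q hq
    refine Submodule.span_induction ?_ ?_ ?_ ?_ hq
    · rintro _ ⟨i, rfl⟩
      obtain ⟨n, hn, hhom⟩ := Z.exists_isHomogeneous_H i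
      rw [MvPolynomial.constantCoeff_eq]
      exact hhom.coeff_eq_zero (by rw [map_zero]; exact hn.ne)
    · simp
    · intro x y _ _ hx hy
      simp [hx, hy]
    · intro a x _ hx
      simp [hx]
  have h1 : (1 : MvPolynomial (Fin 6) k) ∈ Z.ideal := htop ▸ Submodule.mem_top
  simpa using key 1 h1

end CIDatum

/-- Linkage corollary: `P_Z ∉ J^F` follows from `(J^F : P_Z) = ⟨f,g⟩ ≠ (1)` — i.e. `[Z]_prim ≠ 0`.
[cite: Villaflor2022PeriodsCI, Rem 1] -/
theorem transitionDet_not_mem_of_colon_eq {F : MvPolynomial (Fin 6) k} {m : ℕ} (Z : CIDatum F m)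
    (hcolon : (jacobianIdeal F).colon {Z.transitionDet} = Z.ideal) :
    Z.transitionDet ∉ jacobianIdeal F := by
  intro hmem
  apply Z.ideal_ne_top
  rw [← hcolon, eq_top_iff]
  intro r _
  rw [Submodule.mem_colon]
  rintro q rfl
  exact Ideal.mul_mem_left _ r hmem

/-- Linkage corollary in closed form (the registered sub-goal of the crux that this vocabulary file
proves, so that it can ride with `--supports`): `(J^F : P_Z) = ⟨f,g⟩ ⟹ P_Z ∉ J^F`.
[cite: Villaflor2022PeriodsCI, Rem 1] -/
theorem transitionDet_not_mem_jacobianIdeal :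
    ∀ (k : Type u) [Field k] (F : MvPolynomial (Fin 6) k) (m : ℕ) (Z : CIDatum F m)
      (_ : (jacobianIdeal F).colon {Z.transitionDet} = Z.ideal),
      Z.transitionDet ∉ jacobianIdeal F :=
  fun _ _ _ _ Z h => transitionDet_not_mem_of_colon_eq Z h

end Algebra

/-! ## §2 Geometry on real carriers: the embedding and Hartshorne–Serre bundles -/

section Geometry

variable {k : Type u} [Field k]

/-- `ι : X ⟶ ℙ⁵_k` has image the zero locus `V₊(F)` (the shape of `Motives.IsHypersurfaceCutOutBy`).
[folklore] -/
def HasRangeZeroLocus {X : SchemeOver k} (ι : X ⟶ projectiveSpace 5 k)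
    (F : MvPolynomial (Fin 6) k) : Prop :=
  letI := MvPolynomial.gradedAlgebra (σ := Fin 6) (R := k)
  Set.range ι.left.base =
    ProjectiveSpectrum.zeroLocus (MvPolynomial.homogeneousSubmodule (Fin 6) k) {F}

/-- `E` IS A HARTSHORNE–SERRE BUNDLE OF `Z = V₊(f) ∩ X` through the fixed embedding `ι`: the reduced
complete intersection `completeIntersection f ↪ ℙ⁵` factors through `X` by some `j`, and there are a
line bundle `L` on `X`, a line bundle `L_Z` on `Z` and maps `𝒪_X →ˢ E →ᵗ L →ᵛ j_*L_Z` with `s` mono,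
`v` epi, and `(s,t)`, `(t,v)` exact (so `0 → 𝒪_X → E → 𝓘_Z ⊗ L → 0` is the Hartshorne–Serre
extension). [cite: Arrondo2007HartshorneSerre, Thm 1.1] -/
def IsHartshorneSerreOf {X : SchemeOver k} (ι : X ⟶ projectiveSpace 5 k)
    (f : Fin 3 → MvPolynomial (Fin 6) k) (E : X.left.Modules) : Prop :=
  ∃ (j : completeIntersection f ⟶ X) (_ : j ≫ ι = completeIntersectionι f)
    (L : X.left.Modules) (_ : HasRank L 1)
    (LZ : (completeIntersection f).left.Modules) (_ : HasRank LZ 1)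
    (s : unitModule X.left ⟶ E) (t : E ⟶ L)
    (v : L ⟶ (Scheme.Modules.pushforward j.left).obj LZ)
    (hst : s ≫ t = 0) (htv : t ≫ v = 0),
    Mono s ∧ Epi v ∧ (ShortComplex.mk s t hst).Exact ∧ (ShortComplex.mk t v htv).Exact

end Geometry

/-! ## §3 Characters of the Fermat fourfold and CI-type supply data -/

section Characters

variable {k : Type u} [Field k]

/-- ADMISSIBLE character of `X⁴_m`: `a : (ℤ/m)⁶`, all `aᵢ ≠ 0`, `Σ aᵢ = 0` (Shioda's `𝔄⁴_m`).
[cite: Shioda1979HodgeFermat, §1] -/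
def IsAdmissible (m : ℕ) (a : Fin 6 → ZMod m) : Prop :=
  (∀ i, a i ≠ 0) ∧ ∑ i, a i = 0

/-- `a` is of HODGE TYPE `(2,2)`: `Σ val(aᵢ) = 3m`. [cite: Shioda1979HodgeFermat, Thm I] -/
def IsTypeTwoTwo (m : ℕ) (a : Fin 6 → ZMod m) : Prop :=
  ∑ i, (a i).val = 3 * m

/-- TOTALLY HODGE: every unit multiple `t·a` is of type `(2,2)`. [cite: Shioda1979HodgeFermat, Thm I] -/
def IsTotallyHodge (m : ℕ) (a : Fin 6 → ZMod m) : Prop :=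
  ∀ t : (ZMod m)ˣ, IsTypeTwoTwo m (fun i => (t : ZMod m) * a i)

/-- SATURATED: admissible, and every multiple `j·a` without a zero entry is of type `(2,2)` (then the
class of an `H_a`-stable cycle is automatically in `F²`). [folklore] -/
def IsSaturated (m : ℕ) (a : Fin 6 → ZMod m) : Prop :=
  IsAdmissible m a ∧ ∀ j : ZMod m, (∀ i, j * a i ≠ 0) → IsTypeTwoTwo m (fun i => j * a i)

/-- Saturated characters are totally Hodge (unit multiples have no zero entry). [folklore] -/
theorem IsSaturated.isTotallyHodge {m : ℕ} {a : Fin 6 → ZMod m} (h : IsSaturated m a) :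
    IsTotallyHodge m a :=
  fun t => h.2 (t : ZMod m) fun i ht => h.1.1 i ((Units.mul_right_eq_zero t).mp ht)

/-- THREE-PAIR character: `{0,…,5}` splits into three pairs `{i,j}` with `aᵢ + aⱼ = 0` (the characters
carried by LINEAR cycles `x_i = ζ x_j`). [cite: Shioda1979HodgeFermat, §1] -/
def IsThreePair (m : ℕ) (a : Fin 6 → ZMod m) : Prop :=
  ∃ σ : Equiv.Perm (Fin 6), a (σ 0) + a (σ 1) = 0 ∧ a (σ 2) + a (σ 3) = 0 ∧ a (σ 4) + a (σ 5) = 0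

/-- `P` is an `H_a`-EIGENPOLYNOMIAL (`H_a = ker(a) ⊂ (ℤ/m)⁶` acting diagonally): any two monomials of
`P` have exponents differing by a multiple of `a` mod `m`. [folklore] -/
def IsEigenpoly (m : ℕ) (a : Fin 6 → ZMod m) (P : MvPolynomial (Fin 6) k) : Prop :=
  ∀ e ∈ P.support, ∀ e' ∈ P.support, ∃ j : ZMod m,
    ∀ i, ((e i : ℕ) : ZMod m) - ((e' i : ℕ) : ZMod m) = j * a i

/-- The exponent `a − 1 = (val a₀ − 1, …, val a₅ − 1)`: `x^{a−1}` spans the `a`-eigenline of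
`R^F_{3m−6} ≅ H^{2,2}_prim` for the Fermat form. [cite: Shioda1979HodgeFermat, §1] -/
def charExponent (m : ℕ) (a : Fin 6 → ZMod m) : Fin 6 →₀ ℕ :=
  Finsupp.equivFunOnFinite.symm fun i => (a i).val - 1

/-- Rescaling the variables, `xᵢ ↦ cᵢ xᵢ` (the diagonal action of `μ_m⁶` when `cᵢ^m = 1`). [folklore] -/
def rescale (c : Fin 6 → k) : MvPolynomial (Fin 6) k →ₐ[k] MvPolynomial (Fin 6) k :=
  MvPolynomial.aeval fun i => MvPolynomial.C (c i) * MvPolynomial.X i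

namespace CIDatum

variable {m : ℕ}

/-- `Z` is `H_a`-STABLE: all six forms are `H_a`-eigenpolynomials. [folklore] -/
def IsStableUnder (Z : CIDatum (fermatPolynomial k 4 m) m) (a : Fin 6 → ZMod m) : Prop :=
  (∀ i, IsEigenpoly m a (Z.f i)) ∧ ∀ i, IsEigenpoly m a (Z.g i)

/-- `Z` is VISIBLE AT `a`: the `x^{a−1}`-coefficient of `P_Z` is non-zero (the `V_a`-component of
`[Z]_prim` mod `J^F = (xᵢ^{m−1})` is non-zero). [cite: Villaflor2022PeriodsCI, Thm 1] -/
def VisibleAt (Z : CIDatum (fermatPolynomial k 4 m) m) (a : Fin 6 → ZMod m) : Prop :=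
  MvPolynomial.coeff (charExponent m a) Z.transitionDet ≠ 0

/-- `Z` is a DIAGONAL TRANSLATE of `Z₀` by `m`-th roots of unity. [folklore] -/
def IsTranslateOf (Z Z₀ : CIDatum (fermatPolynomial k 4 m) m) : Prop :=
  ∃ c : Fin 6 → k, (∀ i, c i ^ m = 1) ∧ (∀ i, Z.f i = rescale c (Z₀.f i)) ∧
    ∀ i, Z.g i = rescale c (Z₀.g i)

/-- `Z` LIFTS TO `W(k)` as a CI-type datum of the Fermat form over the Witt vectors. [folklore] -/
def LiftsToWitt (p : ℕ) [Fact p.Prime] [CharP k p] (Z : CIDatum (fermatPolynomial k 4 m) m) : Prop :=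
  ∃ f' g' : Fin 3 → MvPolynomial (Fin 6) (WittVector p k),
    (∀ i, (f' i).IsHomogeneous (Z.d i)) ∧ (∀ i, (g' i).IsHomogeneous (m - Z.d i)) ∧
    ∑ i, f' i * g' i = ∑ i : Fin 6, (MvPolynomial.X i : MvPolynomial (Fin 6) (WittVector p k)) ^ m ∧
    (∀ i, MvPolynomial.map (WittVector.constantCoeff : WittVector p k →+* k) (f' i) = Z.f i) ∧
    ∀ i, MvPolynomial.map (WittVector.constantCoeff : WittVector p k →+* k) (g' i) = Z.g i

/-- GOOD at `a`: `H_a`-stable with `a` saturated (character bookkeeping), or liftable (lifting) — the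
two mechanisms that make the Bloch–Esnault–Kerz Hodge condition of `E_Z` automatic. [folklore] -/
def Good (p : ℕ) [Fact p.Prime] [CharP k p] (a : Fin 6 → ZMod m)
    (Z : CIDatum (fermatPolynomial k 4 m) m) : Prop :=
  (IsSaturated m a ∧ Z.IsStableUnder a) ∨ Z.LiftsToWitt p

end CIDatum

end Characters

end Summit.HodgeConjecture.HodgeConjecture.Theorems.SemiregularSeedsOnAnchors.GorensteinCiSeeds

end
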